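/-
Origin: expansion seat `planner-pub-hodgecm-mc-axioms-1-g14-0`, handover #W146 2026-08-20T15:53:55Z md5 fd90ad1304e7 (PKG 28030421d92c → fd90ad1304e7; 110 l.; MECHANICAL (iib-R) rewrite v3.1 of the PKG file as it stands (28 token edits; rules R1x1+RX[h₂]x27)) (`HOME/mc/pub-hodgecm-mc-axioms-1-g14/revendor/kit-r55/stage55/HodgeCM/Model/HLiuOfSmall.lean`, md5 fd90ad1304e7, 110 lines);
landed by the gen-22 packager (p-g22) in gate run 55 REPLACES the earlier landed copy of `HodgeCM/Model/HLiuOfSmall.lean` (seat copy carried the packager Origin header of an earlier run (stripped)).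
-/
/-
r2 RE-CUT by CONSTRUCTION seat `planner-pub-hodgecm-mc-axioms-1-g11-0` (unit pub-hodgecm-mc-axioms-1-g11, gen 11 of mc-axioms-1,
MODEL-DAG node N-i1 (L-lvl)), 2026-08-19T17:55Z, of this lineage's RUN-37 row #2 (kit `t38-mcaxioms1g10.txt` ae277a62a216 #2,
r1 80e83afea299) — the ONE-TOKEN FOLLOW-UP announced in the gen-10 block below, nothing else: theta-3-g9's (Θ-sat) PIN PACKET
(kit `t37-mctheta3g9.txt` e2844b4fb1c2; courtesy row #C2 `HodgeCM/Model/ThetaSatDischarge.lean` 778996c3b32b; STATUS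
2026-08-19T17:40:23Z «CONFIRMED») re-types `Model.thetaSatOf` along the (W1) `K`-order — binder `(hle : Γ' ≤ Γ)`, conclusion over
`coverOf … hA Γ Γ' (Level.Γ_mono hle)` — which is LITERALLY the hypothesis `hΘ` of the RUN-37 `LevelDescent` twin
(`Universe.ThetaModel.thetaAlbanese_of_small`, t38 #1 dda83f0b81dd :274–:275).  Hence the ADAPTER
`fun V c i Γ Γ' h' => thetaSatOf … hA V c i Γ Γ' (Level.Γ_mono h')` COLLAPSES to the bare partial application `thetaSatOf … hA`
(one code line; statement = E's binder `hLiu`, byte-identical to r1; imports unchanged).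
WORLD COUPLING (packager): r2 elaborates EXACTLY in a world whose installed `Model/ThetaSatDischarge` carries the `(hle : Γ' ≤ Γ)`
binder (#C2 778996c3b32b or a successor re-cut of it); r1 80e83afea299 EXACTLY in a world whose installed `thetaSatOf` keeps
`(hle : Γ'.Γ ≤ Γ.Γ)` (the RUN-35/36 PKG file ed6eac548ab5).  INSTALL r2 XOR r1, keyed to #C2 riding in the SAME run; rows #1/#3/#4 of
t38 are unaffected (#3/#4 do not mention `thetaSatOf`; #1 only in comments).
-/
/-
RUN-37 `K`-ORDER TWIN by CONSTRUCTION seat `planner-pub-hodgecm-mc-axioms-1-g10-0` (unit pub-hodgecm-mc-axioms-1-g10, gen 10 of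
mc-axioms-1, MODEL-DAG node N-i1 (L-lvl)), 2026-08-19, of the installed RUN-35 ″ row `HodgeCM/Model/HLiuOfSmall.lean` (kit t36 #10 r2 ef17b52e875f,
installed f0e98a59cf9e) — WHOLE-FILE REPLACEMENT.
RE-TYPING OF RECORD (BINDER-TRIAGE §57/§58/§60; ±0 binders, no statement strengthened): `hsmall` in the (W1) `K`-order
`∃ Γ₀, ∀ Γ ≤ Γ₀, …` (was `∀ Γ, Γ.Γ ≤ Γ₀.Γ → …`; E then assumes isotypy on FEWER levels — [Liu21] «K sufficiently small»,
PerL l. 533 «K'_f ⊆ K_f»); the level-transfer family `D Γ Γ₁ (hle : Γ₁.Γ ≤ Γ.Γ)` KEEPS the `.Γ`-order (geometry); the theta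
saturation is fed to the `K`-order `hΘ` of the RUN-37 `LevelDescent` twin through the ADAPTER
`fun V c i Γ Γ' h' => thetaSatOf … hA V c i Γ Γ' (Level.Γ_mono h')` (valid against TODAY's `Model.thetaSatOf`, binder
`(hle : Γ'.Γ ≤ Γ.Γ)`; should theta-3's (Θ-sat-K) packet re-type `thetaSatOf` along `(h : Γ' ≤ Γ)` the adapter collapses to
`thetaSatOf … hA` — a one-token follow-up re-cut, posted the same hour).
CONCLUSION = E's binder `hLiu` — `Model/E2InstanceR15A.lean` ″ 25ae7f12b9dc :86–:90 (= R10″ … R17A″) — BYTE-FOR-BYTE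
(glue-1-g6 2026-08-19T15:58:17Z: the row-9 bytes for RUN 37 ARE today's; its RUN-37 corollary leaf `Model/E2InstanceR18[A]`
takes this file's `hsmall` text verbatim and applies the wrapper inside its body — nothing of this lineage enters the parent
E term).  (W1) WORLD member: INSTALL in the SAME run as the (W1) root `CM/Basic.lean` #342 66bed69a8c74 (kit t37-mcglue1g6.txt)
and as this lineage's RUN-37 `LevelDescent` twin, after both; the four axioms-1 RUN-37 rows replace their installed twins
TOGETHER (none elaborates in a mixed world).
-/
/-
v2 ″ RE-CUT by CONSTRUCTION seat `planner-pub-hodgecm-mc-axioms-1-g7-0` (unit pub-hodgecm-mc-axioms-1-g7, gen 7 of mc-axioms-1), 2026-08-19T07:45Z,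
of the gen-6 row `HodgeCM/Model/HLiuOfSmall.lean` 4cdd08f8047e (kit t35-mcaxioms1g6 #2): the `hι` binder is DROPPED and
`thetaSatOf … hA hι` ↦ `thetaSatOf … hA` — nothing else (finding mc-glue-1-g5 2026-08-19T07:36:04Z; under the theta-3 v2 joint cut
`ThetaAdelicSide.ιinf` is level-free and period-1 #35″ `Model.thetaSatOf … hA` takes no `hι`). JOINT-CUT MEMBER: install this ″ row
XOR the v1 row 4cdd08f8047e, paired with the ″ world (R10″ `E2InstanceR10` + #35″ `ThetaSatDischarge`), exactly like E's ″ rows.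
-/
/-
Origin: CONSTRUCTION seat `planner-pub-hodgecm-mc-axioms-1-g6-0` (unit pub-hodgecm-mc-axioms-1-g6, gen 6 of mc-axioms-1,
MODEL-DAG node N-i1 (L-lvl)), 2026-08-19.  NEW additive leaf `HodgeCM/Model/HLiuOfSmall.lean`.  Imports: `E2InstanceR10`
(RUN-33 gate of record; used only for the NAMES occurring in the E term — `thetaModelOf`, `picardCMUniverse`, `coverOf`,
…; and `Model.thetaSatOf` of the installed `Model/ThetaSatDischarge`, which R10 imports) and this lineage's
`Model/LevelDescent`.  Nothing imports this file (bounce-isolated).  No proof holes, no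
records.  Expected `#print axioms`: {propext, Classical.choice, Quot.sound}.
CONTENT: the E binder `hLiu` of `Model.perL_picardCM_rNcore` (byte-identical for N = 10 … 16) is LITERALLY the
conclusion of `ThetaModel.thetaAlbanese_of_small` at `T := thetaModelOf …`, `U := picardCMUniverse …`.
-/
import Summits.HodgeConjecture.HodgeCM.Model.E2InstanceR10
import Summits.HodgeConjecture.HodgeCM.Model.LevelDescent

/-! PORT of `HodgeCM/Model/HLiuOfSmall.lean` (HodgeCMPerL run 82) — verbatim mechanical port; provenance in the PORT header line. -/

noncomputable section

open scoped TensorProduct InnerProductSpace Matrix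

namespace HodgeCM

namespace Model

open HodgeCM.Universe (AdelicThetaCore AdelicThetaCore₀ SideData ThetaModel ModelAxiomsPerL LevelTransfer)
open Literature.AlgebraicGeometry.HodgeTheory
open Literature.AlgebraicGeometry.ComplexMultiplication (Shimura1998_Thm3_isogenousPower Shimura1998_Thm2_Cor)
open Literature.NumberTheory.Automorphic.PicardCM
open Literature.NumberTheory.Transcendental (Arapura2012_Cor_15_4_6)
open HodgeCM.CMTypeOps (inflate)
open HodgeCM.Model.SupplyResidual (ClassSupplyPackN)
open HodgeCM.Model.ThetaSpace

variable (hHD : exists_isReal_hodgeModel) (hI : hodgePQ_independent_of_hodgeModel)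
  (h₁ : BallQuotientUniformised)  (h₃ : CMAbelianVarietyRealised)

/-- `hLiu_of_small` for the E term: the conclusion is the binder `hLiu` of `Model.perL_picardCM_r10core` (text copied
VERBATIM from `E2InstanceR10.lean`; = `E2InstanceR13.lean` ll. 72–76, diff-certified identical; byte-identical in
R10–R16).  Hypotheses: `D` — a level-transfer datum (`Universe.LevelTransfer`, this lineage's DATA interface) on every
covering `Model.coverOf … hA Γ Γ₁ hle` of the tower (RUN 35+, to be CONSTRUCTED by the universe / glue lanes); (v2 ″ re-cut: NO `hι`
binder — under the theta-3 v2 joint cut `ιinf` is level-free and `Model.thetaSatOf … hA` (period-1 #35″ `ThetaSatDischarge`)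
supplies the theta saturation along `cover` without it); `hsmall` — the [Liu21] record in the (L-lvl) shape `∃ Γ₀ ∀ Γ ≤ Γ₀`.  So, given the data
`D`, the binder `hLiu` REDUCES to its small-level form with no further input. -/
theorem hLiu_of_small (h : Bool) (hA : Arapura2012_Cor_15_4_6)
    (W : ∀ {L : CMField} {ι₁ : L →+* ℂ} (V : HermSpace3 L ι₁) (c : SeesawCtx L), WmInput V c.D)
    (S : ∀ {L : CMField} {ι₁ : L →+* ℂ} (V : HermSpace3 L ι₁) (c : SeesawCtx L), ThetaAdelicSide V c)
    (μ : ∀ {L : CMField}, SeesawCtx L → Fin 4 → NumberField.InfinitePlace L → ℤ)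
    (D : ∀ {L : CMField} {ι₁ : L →+* ℂ} {V : HermSpace3 L ι₁} (Γ Γ₁ : Level V) (hle : Γ₁.Γ ≤ Γ.Γ),
      (picardCMUniverse hHD hI h₁ h₃).LevelTransfer (coverOf hHD hI h₁ h₃ hA Γ Γ₁ hle))
    (hsmall : ∀ {L : CMField} {ι₁ : L →+* ℂ} (V : HermSpace3 L ι₁) (c : SeesawCtx L),
      (thetaModelOf hHD hI h₁ h₃ h (embOf hHD hI h₁ h₃) (coverOf hHD hI h₁ h₃ hA) (wmOfInput W) (thetaOf _ (thetaClassInputOf _ (fun V c => thetaSpaceInputOf hHD hI h₁ h₃ S V c))) (d12Of μ) (d34Of μ)).GoodCtx ι₁ c → Module.finrank ℚ c.K = 6 →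
      ∀ i : Fin 4, ∃ Γ₀ : Level V, ∀ Γ ≤ Γ₀,
        ∃ (M : CMField) (k : c.K →+* M) (σ' : M →+* ℂ), σ'.comp k = c.σ ∧
        (thetaModelOf hHD hI h₁ h₃ h (embOf hHD hI h₁ h₃) (coverOf hHD hI h₁ h₃ hA) (wmOfInput W) (thetaOf _ (thetaClassInputOf _ (fun V c => thetaSpaceInputOf hHD hI h₁ h₃ S V c))) (d12Of μ) (d34Of μ)).Theta V c i Γ ⊆
          (picardCMUniverse hHD hI h₁ h₃).Uiso Γ M (inflate k (c.Ψ i)) σ') :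
    ∀ {L : CMField} {ι₁ : L →+* ℂ} (V : HermSpace3 L ι₁) (c : SeesawCtx L),
      (thetaModelOf hHD hI h₁ h₃ h (embOf hHD hI h₁ h₃) (coverOf hHD hI h₁ h₃ hA) (wmOfInput W) (thetaOf _ (thetaClassInputOf _ (fun V c => thetaSpaceInputOf hHD hI h₁ h₃ S V c))) (d12Of μ) (d34Of μ)).GoodCtx ι₁ c → Module.finrank ℚ c.K = 6 →
      ∀ (i : Fin 4) (Γ : Level V), ∃ (M : CMField) (k : c.K →+* M) (σ' : M →+* ℂ), σ'.comp k = c.σ ∧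
        (thetaModelOf hHD hI h₁ h₃ h (embOf hHD hI h₁ h₃) (coverOf hHD hI h₁ h₃ hA) (wmOfInput W) (thetaOf _ (thetaClassInputOf _ (fun V c => thetaSpaceInputOf hHD hI h₁ h₃ S V c))) (d12Of μ) (d34Of μ)).Theta V c i Γ ⊆
          (picardCMUniverse hHD hI h₁ h₃).Uiso Γ M (inflate k (c.Ψ i)) σ' :=
  (thetaModelOf hHD hI h₁ h₃ h (embOf hHD hI h₁ h₃) (coverOf hHD hI h₁ h₃ hA) (wmOfInput W) (thetaOf _ (thetaClassInputOf _ (fun V c => thetaSpaceInputOf hHD hI h₁ h₃ S V c))) (d12Of μ) (d34Of μ)).thetaAlbanese_of_small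
    D (thetaSatOf hHD hI h₁ h₃ (S := S) h (embOf hHD hI h₁ h₃) (wmOfInput W) (d12Of μ) (d34Of μ) hA) hsmall


end Model

end HodgeCM

end
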